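import Literature.Barriers.BirchSwinnertonDyer.PAdicHeightNondegeneracy
import Literature.NumberTheory.EllipticCurves.PAdicGrossZagierConstantTermProofs
import HarnessLib

/-!
# Barrier (BirchSwinnertonDyer): `p`-adic height non-degeneracy — the analytic face in rank one
reduces EXACTLY to the derivative clause of Perrin-Riou's theorem (proofs companion)

Second `Proofs` companion of `Literature/Barriers/BirchSwinnertonDyer/PAdicHeightNondegeneracy.lean`
(Mathlib/Literature-only proofs; NO new facts). That file catalogues the analytic face of the
barrier under the name `Literature.Barriers.BirchSwinnertonDyer.PAdicHeightBarrier`, whose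
STATEMENT is "in analytic rank one over `K`, `ord_{T=0} L_p(E/K,T) = ord_{s=1} L(E/K,s) ↔
⟨P_K,P_K⟩_p ≠ 0`" (for all `E/ℚ` globally minimal of conductor `N`, `p ≥ 5` good ordinary, `K`
imaginary quadratic with odd `d_K` coprime to `N`, Heegner hypothesis, `p` split, newforms `f, g`
of `E, E^{(d_K)}`, THE canonical cyclotomic `p`-adic height `DK` on `E(K)`, every Heegner point
`P_K`), and obtains it from the named fact
`Literature.NumberTheory.EllipticCurves.perrinRiou_padicGrossZagier`, the normalisation-free form
of Perrin-Riou's `p`-adic Gross–Zagier theorem, which has TWO clauses: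

* (constant term) `L_p(E/K, T)` has constant term `0`;
* (derivative) `coeff_1 L_p(E/K, T) = 0 ↔ ⟨P_K, P_K⟩_{p,K} = 0`.

Source, read for this file from the original (B. Perrin-Riou, *Points de Heegner et dérivées de
fonctions `L` `p`-adiques*, Invent. Math. 89 (1987) 455–510, GDZ scan): §1.4, p. 461, standing
hypotheses "`p` ne divise pas `N`, `f` est ordinaire en `i_p`, tout diviseur premier de `Np` se
décompose dans `k` et `D` est impair", `L'_{p,ρ}(f,𝒞) := (d/ds) L_p(f,𝒞)(ρ^s)|_{s=0}`;
**Théorème 1.3**: "La fonction `L_p(f,𝒞)` s'annule en `𝟙` et sa dérivée en `𝟙` dans la direction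
`ρ` vaut `L'_{p,ρ}(f,𝒞) = ∏_{𝔭∣p} (1 - 𝒞(𝔭)/α_{N𝔭}(f))(1 - 𝒞̄(𝔭)/α_{N𝔭}(f)) ·
⟨y_{𝒞,f}, y_{𝒞̄,f}⟩_{ρ_H} / (h u²)`"; p. 463, the same for a modular elliptic curve `E` of
conductor `N` with `π : X₀(N) → E`, `π(∞) = 0`, `L_p(E,𝒞) := L_p(f,𝒞)` and the canonical height
of Schneider and Mazur–Tate on `E`:
`L'_{p,ρ}(E,𝒞) = ∏_{𝔭∣p}(…)(…) ⟨Q^{(π)}_𝒞, Q^{(π)}_𝒞̄⟩_{ρ_H,E} / (h u² deg π)`; p. 459, (1.1):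
`L_p(f,𝒞₀)(ν) = L_p(f)(ν_ℚ) L_p(f^{(ε)})(ν_ℚ) (Ω_f/√|D|)⁻¹` (restriction to the cyclotomic line =
product of the two Mazur–Swinnerton-Dyer functions, the tree's `padicLFunctionEK`, up to a
non-zero constant); p. 461: "L'équation fonctionnelle de `L_p(f,𝒞)` implique que `L_p(f,𝒞)(𝟙)`
est nul" (the constant-term clause).

In this file the barrier statement is always WRITTEN OUT (the `∀`-statement above), never
referred to through the constant `PAdicHeightBarrier`, so that nothing here depends on how the
catalogue entry packages it — a closed `Prop`, as until the D-0026 review of 2026-08-15, or a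
theorem relative to the fact `perrinRiou_padicGrossZagier`, as since (see the module docstring of
`PAdicHeightNondegeneracy.lean`).

The constant-term clause is a THEOREM of the tree in positive analytic rank over `K`
(`Literature.NumberTheory.EllipticCurves.constantCoeff_padicLFunctionEK_eq_zero_of_analyticRankEK_ne_zero`,
file `PAdicGrossZagierConstantTermProofs.lean`: interpolation property of Mazur–Tate–Teitelbaum at
the trivial character plus `L(E/K, 1) = 0`). This file proves that, consequently, the barrier
statement is EQUIVALENT to the derivative clause of Théorème 1.3 restricted to analytic rank one —
no more and no less:

* `PowerSeries.order_eq_one_iff_coeff_one_ne_zero`: for a power series with zero constant term,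
  `order = 1 ↔ coeff_1 ≠ 0` (elementary);
* `padicOrderEK_eq_analyticRankEK_iff_coeff_one_ne_zero`: under `p ≥ 5` good ordinary and split in
  the imaginary quadratic field `K`, if `ord_{s=1} L(E/K,s) = 1` then
  `ord_{T=0} L_p(E/K,T) = ord_{s=1} L(E/K,s) ↔ coeff_1 L_p(E/K,T) ≠ 0` (PROVED, no fact);
* `padicHeightBarrier_iff_forall_coeff_one_iff`: (barrier statement) `↔` "for all data as in the
  barrier, `analyticRankEK W K = 1 → (coeff_1 L_p(E/K,T) = 0 ↔ ⟨P_K,P_K⟩_{p,K} = 0)`", i.e. the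
  barrier statement IS the analytic-rank-one case of the derivative clause of Perrin-Riou 1987,
  Thm. 1.3 (in the tree's normalisation-free form); `padicHeightBarrier_of_forall_coeff_one_iff`
  is the useful direction and `PAdicHeightBarrier.coeff_one_eq_zero_iff` the pointwise converse
  (the barrier statement taken as the hypothesis `h`).
* (No separate named fact for the derivative clause.) The derivative clause of Thm. 1.3 is NOT
  an independent fact of the tree: by `perrinRiou_padicGrossZagier_iff_derivative`
  (`PAdicGrossZagierProofs.lean`, where the constant-term clause is proved outright from the
  Heegner point's parametrisation datum) it is logically equivalent to the named fact
  `Literature.NumberTheory.EllipticCurves.perrinRiou_padicGrossZagier` itself, so a `def` isolating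
  it would merely restate that fact (D-0026 review, 2026-08-15: the former derivative-clause
  `def` of `PAdicGrossZagierProofs.lean` was merged back into its parent). By the same token the
  rank-one barrier statement is a SLICE of that fact (this file), which is why, since the D-0026
  review of the barrier (2026-08-15), the catalogue entry `PAdicHeightBarrier` is a theorem
  relative to `perrinRiou_padicGrossZagier` and not a named fact of its own;
  `padicHeightBarrier_of_forall_coeff_one_iff` records that only the analytic-rank-one case of
  the fact's second conjunct is consumed.
* `padicHeightBarrierNarrow_iff`, `padicHeightBarrierNarrow_iff_forall_coeff_one_iff`: the
  statement of the NARROWED barrier `PAdicHeightBarrierNarrow` of the barrier audit (2026-08-15) —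
  (barrier statement) `∧` the pair / conjugate-pair algebra behind the critical-slope and
  supersingular evasions — has its second conjunct PROVED in the barrier file
  (`padicHeightBarrierNarrow_gap`), so it is equivalent to the barrier statement, hence again
  exactly to the analytic-rank-one derivative clause; its only upstream input is the same named
  fact `perrinRiou_padicGrossZagier`.

So what separates the barrier statement from a closed proof is precisely the `p`-adic Gross–Zagier
derivative formula in analytic rank one (Perrin-Riou's §§2–5: `p`-adic Rankin–Selberg
construction of `L_p(f,𝒞)` with Hida's ordinary projector, `q`-expansion of the derivative,
`p`-adic heights on `J₀(N)` as sums of local symbols, Gross–Zagier intersection theory at `v ∤ p`,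
and the §5.3 treatment of `v ∣ p`), none of whose objects exists in Mathlib or Literature; the
constant-term clause and the higher-analytic-rank part of Thm. 1.3 are NOT needed for it.

## References

* [PerrinRiou1987] B. Perrin-Riou, Invent. Math. 89 (1987), §1.1 (1.1) p. 459, §1.4 Thm. 1.3
  p. 461 and its elliptic-curve form p. 463, §1.5 (plan of proof) pp. 465–466.
* [GreenbergLNM1716] R. Greenberg, LNM 1716 (1999), §4 (Perrin-Riou's result for `L_p(E/ℚ)`).
* B. Mazur, J. Tate, J. Teitelbaum, Invent. Math. 84 (1986), §I.14 (14.3) (constant term).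
-/

noncomputable section

open scoped Classical MatrixGroups ModularForm

open CongruenceSubgroup NumberField WeierstrassCurve Literature.NumberTheory.EllipticCurves.ModularForms Literature.NumberTheory.EllipticCurves

/-! ### An elementary power-series lemma -/

namespace PowerSeries

/-- A formal power series with zero constant term has order exactly `1` iff its linear
coefficient is non-zero (Mathlib `PowerSeries.order_eq_nat` at `n = 1`). [folklore] -/
theorem order_eq_one_iff_coeff_one_ne_zero {R : Type*} [Semiring R] {φ : R⟦X⟧}
    (h0 : constantCoeff φ = 0) : φ.order = 1 ↔ coeff 1 φ ≠ 0 := by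
  rw [show (1 : ℕ∞) = ((1 : ℕ) : ℕ∞) from rfl, order_eq_nat]
  constructor
  · exact fun h ↦ h.1
  · intro h
    refine ⟨h, fun i hi ↦ ?_⟩
    obtain rfl : i = 0 := by omega
    rwa [coeff_zero_eq_constantCoeff_apply]

end PowerSeries

namespace Literature.Barriers.BirchSwinnertonDyer

/-! ### In analytic rank one, "`p`-adic order = complex order" means `coeff_1 L_p(E/K) ≠ 0` -/

section RankOne

variable {W : WeierstrassCurve ℚ} [W.IsElliptic] [W.IsGloballyMinimal] {p : ℕ} [Fact p.Prime]
  {K : Type} [Field K] [NumberField K]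
  {Nf Ng : ℕ} [NeZero Nf] [NeZero Ng] {f : CuspForm (Gamma0 Nf) 2} {g : CuspForm (Gamma0 Ng) 2}
  (hf : IsNewformOf W f) (hg : IsNewformOf (W.quadraticTwist (NumberField.discr K : ℚ)) g)

/-- **Constant term, proved.** For `E/ℚ` (globally minimal `W`), `p ≥ 5` good ordinary and split
in the imaginary quadratic field `K`, in analytic rank one over `K` the cyclotomic `p`-adic
`L`-function `L_p(E/K, T)` (`padicLFunctionEK`) has constant term `0` — the first clause of
Perrin-Riou 1987, Thm. 1.3 ("`L_p(f,𝒞)` s'annule en `𝟙`", p. 461, with (1.1) p. 459), here a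
consequence of the tree theorem
`constantCoeff_padicLFunctionEK_eq_zero_of_analyticRankEK_ne_zero` (Mazur–Tate–Teitelbaum
interpolation at the trivial character and `L(E/K,1) = 0`). [cite: PerrinRiou1987, Thm. 1.3] -/
theorem constantCoeff_padicLFunctionEK_eq_zero_of_analyticRankEK_eq_one (hp : 5 ≤ p)
    (hgood : W.HasGoodReductionAtPrime p) (hord : ¬ (p : ℤ) ∣ W.frobeniusTrace p)
    (hK : IsImaginaryQuadratic K) (hsplit : ((Ideal.span {(p : ℤ)}).primesOver (𝓞 K)).ncard = 2)
    (hr : analyticRankEK W K = 1) :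
    PowerSeries.constantCoeff (padicLFunctionEK W p K hf hg) = 0 :=
  constantCoeff_padicLFunctionEK_eq_zero_of_analyticRankEK_ne_zero W p K hf hg (by omega) hgood
    hord hK.1 hsplit (by omega)

/-- **In analytic rank one, `ord_{T=0} L_p(E/K,T) = ord_{s=1} L(E/K,s) ↔ coeff_1 L_p(E/K,T) ≠ 0`**
(PROVED, no named fact): the constant term vanishes
(`constantCoeff_padicLFunctionEK_eq_zero_of_analyticRankEK_eq_one`), so the `p`-adic order is
`≥ 1`, and it equals `1 = ord_{s=1} L(E/K,s)` iff the linear coefficient is non-zero. This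
isolates what the comparison of orders needs from Perrin-Riou's theorem: only the DERIVATIVE
clause (Perrin-Riou 1987, Thm. 1.3, p. 461; `E`-form p. 463). [cite: PerrinRiou1987, Thm. 1.3] -/
theorem padicOrderEK_eq_analyticRankEK_iff_coeff_one_ne_zero (hp : 5 ≤ p)
    (hgood : W.HasGoodReductionAtPrime p) (hord : ¬ (p : ℤ) ∣ W.frobeniusTrace p)
    (hK : IsImaginaryQuadratic K) (hsplit : ((Ideal.span {(p : ℤ)}).primesOver (𝓞 K)).ncard = 2)
    (hr : analyticRankEK W K = 1) :
    (padicLFunctionEK W p K hf hg).order = (analyticRankEK W K : ℕ∞) ↔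
      PowerSeries.coeff 1 (padicLFunctionEK W p K hf hg) ≠ 0 := by
  rw [hr, Nat.cast_one]
  exact PowerSeries.order_eq_one_iff_coeff_one_ne_zero
    (constantCoeff_padicLFunctionEK_eq_zero_of_analyticRankEK_eq_one hf hg hp hgood hord hK hsplit hr)

end RankOne

/-! ### The barrier is exactly the derivative clause of Perrin-Riou's theorem in analytic rank one -/

section Characterisation

/-- **The barrier statement ↔ the derivative clause of Perrin-Riou 1987, Thm. 1.3, in analytic
rank one.** The statement of the barrier `PAdicHeightBarrier`, written out on the left-hand side
(for all `E/ℚ` globally minimal of conductor `N`,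
`p ≥ 5` good ordinary, `K` imaginary quadratic with odd `d_K` coprime to `N`, Heegner hypothesis,
`p` split, newforms `f, g` of `E, E^{(d_K)}`, THE canonical cyclotomic `p`-adic height `DK` on
`E(K)`, every Heegner point `P_K`: `analyticRankEK W K = 1 → (ord_{T=0} L_p(E/K,T) =
ord_{s=1} L(E/K,s) ↔ ⟨P_K,P_K⟩_p ≠ 0)`) is EQUIVALENT to the statement obtained by replacing its
conclusion with `analyticRankEK W K = 1 → (coeff_1 L_p(E/K,T) = 0 ↔ ⟨P_K,P_K⟩_p = 0)` — the
second conjunct of the tree fact `Literature.NumberTheory.EllipticCurves.perrinRiou_padicGrossZagier`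
(Perrin-Riou's derivative formula `L'_{p,ρ}(E,𝒞₀) = (1 - 1/α_p)⁴ ⟨Q,Q⟩_{ρ_H,E}/(h u² deg π)`,
p. 463, in normalisation-free form) restricted to analytic rank one. Pointwise this is
`padicOrderEK_eq_analyticRankEK_iff_coeff_one_ne_zero` (the constant term being a theorem).
So the barrier needs neither the constant-term clause nor the higher-rank part of Thm. 1.3, and
nothing less than the rank-one derivative formula closes it.
[cite: PerrinRiou1987, Thm. 1.3 (p. 461) and p. 463] -/
theorem padicHeightBarrier_iff_forall_coeff_one_iff :
    (∀ (W : WeierstrassCurve ℚ) [W.IsElliptic] [W.IsGloballyMinimal] (p : ℕ) [Fact p.Prime]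
        (K : Type) [Field K] [NumberField K] (N : ℕ) [NeZero N]
        {Nf Ng : ℕ} [NeZero Nf] [NeZero Ng] {f : CuspForm (Gamma0 Nf) 2}
        {g : CuspForm (Gamma0 Ng) 2}
        (hf : IsNewformOf W f) (hg : IsNewformOf (W.quadraticTwist (NumberField.discr K : ℚ)) g),
        5 ≤ p → W.HasGoodReductionAtPrime p → ¬ (p : ℤ) ∣ W.frobeniusTrace p →
        IsImaginaryQuadratic K → Odd (NumberField.discr K) →
        IsCoprime (NumberField.discr K) (N : ℤ) → W.conductorNorm ℤ = N →
        SatisfiesHeegnerHypothesis N K → ((Ideal.span {(p : ℤ)}).primesOver (𝓞 K)).ncard = 2 →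
        ∀ (DK : WeierstrassCurve.PAdicHeightDataK W p K), DK.IsCanonical →
        ∀ (P : (W.baseChange K).toAffine.Point), IsHeegnerPoint N W K P →
        analyticRankEK W K = 1 →
          ((padicLFunctionEK W p K hf hg).order = (analyticRankEK W K : ℕ∞) ↔ DK.height P ≠ 0)) ↔
      ∀ (W : WeierstrassCurve ℚ) [W.IsElliptic] [W.IsGloballyMinimal] (p : ℕ) [Fact p.Prime]
        (K : Type) [Field K] [NumberField K] (N : ℕ) [NeZero N]
        {Nf Ng : ℕ} [NeZero Nf] [NeZero Ng] {f : CuspForm (Gamma0 Nf) 2}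
        {g : CuspForm (Gamma0 Ng) 2}
        (hf : IsNewformOf W f) (hg : IsNewformOf (W.quadraticTwist (NumberField.discr K : ℚ)) g),
        5 ≤ p → W.HasGoodReductionAtPrime p → ¬ (p : ℤ) ∣ W.frobeniusTrace p →
        IsImaginaryQuadratic K → Odd (NumberField.discr K) →
        IsCoprime (NumberField.discr K) (N : ℤ) → W.conductorNorm ℤ = N →
        SatisfiesHeegnerHypothesis N K → ((Ideal.span {(p : ℤ)}).primesOver (𝓞 K)).ncard = 2 →
        ∀ (DK : WeierstrassCurve.PAdicHeightDataK W p K), DK.IsCanonical →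
        ∀ (P : (W.baseChange K).toAffine.Point), IsHeegnerPoint N W K P →
        analyticRankEK W K = 1 →
          (PowerSeries.coeff 1 (padicLFunctionEK W p K hf hg) = 0 ↔ DK.height P = 0) := by
  constructor
  · intro h W _ _ p _ K _ _ N _ Nf Ng _ _ f g hf hg hp hgood hord hK hodd hcop hN hH hsplit DK hDK
      P hP hr
    have key := h W p K N hf hg hp hgood hord hK hodd hcop hN hH hsplit DK hDK P hP hr
    rw [padicOrderEK_eq_analyticRankEK_iff_coeff_one_ne_zero hf hg hp hgood hord hK hsplit hr]
      at key
    exact not_iff_not.mp key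
  · intro h W _ _ p _ K _ _ N _ Nf Ng _ _ f g hf hg hp hgood hord hK hodd hcop hN hH hsplit DK hDK
      P hP hr
    rw [padicOrderEK_eq_analyticRankEK_iff_coeff_one_ne_zero hf hg hp hgood hord hK hsplit hr]
    exact not_iff_not.mpr
      (h W p K N hf hg hp hgood hord hK hodd hcop hN hH hsplit DK hDK P hP hr)

/-- **The useful direction: the derivative clause of Perrin-Riou's theorem in analytic rank one
implies the barrier statement** (no constant-term input needed — it is a theorem of the tree).
[cite: PerrinRiou1987, Thm. 1.3 (p. 461) and p. 463] -/
theorem padicHeightBarrier_of_forall_coeff_one_iff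
    (h : ∀ (W : WeierstrassCurve ℚ) [W.IsElliptic] [W.IsGloballyMinimal] (p : ℕ) [Fact p.Prime]
        (K : Type) [Field K] [NumberField K] (N : ℕ) [NeZero N]
        {Nf Ng : ℕ} [NeZero Nf] [NeZero Ng] {f : CuspForm (Gamma0 Nf) 2}
        {g : CuspForm (Gamma0 Ng) 2}
        (hf : IsNewformOf W f) (hg : IsNewformOf (W.quadraticTwist (NumberField.discr K : ℚ)) g),
        5 ≤ p → W.HasGoodReductionAtPrime p → ¬ (p : ℤ) ∣ W.frobeniusTrace p →
        IsImaginaryQuadratic K → Odd (NumberField.discr K) →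
        IsCoprime (NumberField.discr K) (N : ℤ) → W.conductorNorm ℤ = N →
        SatisfiesHeegnerHypothesis N K → ((Ideal.span {(p : ℤ)}).primesOver (𝓞 K)).ncard = 2 →
        ∀ (DK : WeierstrassCurve.PAdicHeightDataK W p K), DK.IsCanonical →
        ∀ (P : (W.baseChange K).toAffine.Point), IsHeegnerPoint N W K P →
        analyticRankEK W K = 1 →
          (PowerSeries.coeff 1 (padicLFunctionEK W p K hf hg) = 0 ↔ DK.height P = 0)) :
    ∀ (W : WeierstrassCurve ℚ) [W.IsElliptic] [W.IsGloballyMinimal] (p : ℕ) [Fact p.Prime]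
      (K : Type) [Field K] [NumberField K] (N : ℕ) [NeZero N]
      {Nf Ng : ℕ} [NeZero Nf] [NeZero Ng] {f : CuspForm (Gamma0 Nf) 2}
      {g : CuspForm (Gamma0 Ng) 2}
      (hf : IsNewformOf W f) (hg : IsNewformOf (W.quadraticTwist (NumberField.discr K : ℚ)) g),
      5 ≤ p → W.HasGoodReductionAtPrime p → ¬ (p : ℤ) ∣ W.frobeniusTrace p →
      IsImaginaryQuadratic K → Odd (NumberField.discr K) →
      IsCoprime (NumberField.discr K) (N : ℤ) → W.conductorNorm ℤ = N →
      SatisfiesHeegnerHypothesis N K → ((Ideal.span {(p : ℤ)}).primesOver (𝓞 K)).ncard = 2 →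
      ∀ (DK : WeierstrassCurve.PAdicHeightDataK W p K), DK.IsCanonical →
      ∀ (P : (W.baseChange K).toAffine.Point), IsHeegnerPoint N W K P →
      analyticRankEK W K = 1 →
        ((padicLFunctionEK W p K hf hg).order = (analyticRankEK W K : ℕ∞) ↔ DK.height P ≠ 0) :=
  padicHeightBarrier_iff_forall_coeff_one_iff.mpr h

/-- **Pointwise converse: the barrier statement yields the derivative clause in analytic rank
one.** Given the barrier statement (hypothesis `h`, the statement of `PAdicHeightBarrier` written
out), under its hypotheses and `analyticRankEK W K = 1`:
`coeff_1 L_p(E/K, T) = 0 ↔ ⟨P_K, P_K⟩_{p,K} = 0` (Perrin-Riou 1987, Thm. 1.3, derivative clause, in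
the tree's normalisation-free form). [cite: PerrinRiou1987, Thm. 1.3 (p. 461) and p. 463] -/
theorem PAdicHeightBarrier.coeff_one_eq_zero_iff
    (h : ∀ (W : WeierstrassCurve ℚ) [W.IsElliptic] [W.IsGloballyMinimal] (p : ℕ) [Fact p.Prime]
        (K : Type) [Field K] [NumberField K] (N : ℕ) [NeZero N]
        {Nf Ng : ℕ} [NeZero Nf] [NeZero Ng] {f : CuspForm (Gamma0 Nf) 2}
        {g : CuspForm (Gamma0 Ng) 2}
        (hf : IsNewformOf W f) (hg : IsNewformOf (W.quadraticTwist (NumberField.discr K : ℚ)) g),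
        5 ≤ p → W.HasGoodReductionAtPrime p → ¬ (p : ℤ) ∣ W.frobeniusTrace p →
        IsImaginaryQuadratic K → Odd (NumberField.discr K) →
        IsCoprime (NumberField.discr K) (N : ℤ) → W.conductorNorm ℤ = N →
        SatisfiesHeegnerHypothesis N K → ((Ideal.span {(p : ℤ)}).primesOver (𝓞 K)).ncard = 2 →
        ∀ (DK : WeierstrassCurve.PAdicHeightDataK W p K), DK.IsCanonical →
        ∀ (P : (W.baseChange K).toAffine.Point), IsHeegnerPoint N W K P →
        analyticRankEK W K = 1 →
          ((padicLFunctionEK W p K hf hg).order = (analyticRankEK W K : ℕ∞) ↔ DK.height P ≠ 0))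
    {W : WeierstrassCurve ℚ} [W.IsElliptic] [W.IsGloballyMinimal] {p : ℕ} [Fact p.Prime]
    {K : Type} [Field K] [NumberField K] {N : ℕ} [NeZero N]
    {Nf Ng : ℕ} [NeZero Nf] [NeZero Ng] {f : CuspForm (Gamma0 Nf) 2} {g : CuspForm (Gamma0 Ng) 2}
    (hf : IsNewformOf W f) (hg : IsNewformOf (W.quadraticTwist (NumberField.discr K : ℚ)) g)
    (hp : 5 ≤ p) (hgood : W.HasGoodReductionAtPrime p) (hord : ¬ (p : ℤ) ∣ W.frobeniusTrace p)
    (hK : IsImaginaryQuadratic K) (hodd : Odd (NumberField.discr K))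
    (hcop : IsCoprime (NumberField.discr K) (N : ℤ)) (hN : W.conductorNorm ℤ = N)
    (hH : SatisfiesHeegnerHypothesis N K)
    (hsplit : ((Ideal.span {(p : ℤ)}).primesOver (𝓞 K)).ncard = 2)
    {DK : WeierstrassCurve.PAdicHeightDataK W p K} (hDK : DK.IsCanonical)
    {P : (W.baseChange K).toAffine.Point} (hP : IsHeegnerPoint N W K P)
    (hr : analyticRankEK W K = 1) :
    PowerSeries.coeff 1 (padicLFunctionEK W p K hf hg) = 0 ↔ DK.height P = 0 :=
  padicHeightBarrier_iff_forall_coeff_one_iff.mp h W p K N hf hg hp hgood hord hK hodd hcop hN hH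
    hsplit DK hDK P hP hr

/-- **In analytic rank one the barrier gives `ord_{T=0} L_p(E/K,T) ≥ 1` unconditionally and
`= 1` exactly when `⟨P_K,P_K⟩_p ≠ 0`.** Restatement of the barrier's conclusion with the
(proved) vanishing of the constant term made explicit: `1 ≤ ord_{T=0} L_p(E/K, T)`, with equality
iff the canonical `p`-adic height of the Heegner point is non-zero (Perrin-Riou 1987, Thm. 1.3;
Greenberg, LNM 1716, §4: "Perrin-Riou's result asserts that `L_p(E/ℚ,s)` also has a simple zero"
when `h_p(P) ≠ 0`). [cite: PerrinRiou1987, Thm. 1.3] [cite: GreenbergLNM1716, §4] -/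
theorem PAdicHeightBarrier.one_le_order_and_order_eq_one_iff
    (h : ∀ (W : WeierstrassCurve ℚ) [W.IsElliptic] [W.IsGloballyMinimal] (p : ℕ) [Fact p.Prime]
        (K : Type) [Field K] [NumberField K] (N : ℕ) [NeZero N]
        {Nf Ng : ℕ} [NeZero Nf] [NeZero Ng] {f : CuspForm (Gamma0 Nf) 2}
        {g : CuspForm (Gamma0 Ng) 2}
        (hf : IsNewformOf W f) (hg : IsNewformOf (W.quadraticTwist (NumberField.discr K : ℚ)) g),
        5 ≤ p → W.HasGoodReductionAtPrime p → ¬ (p : ℤ) ∣ W.frobeniusTrace p →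
        IsImaginaryQuadratic K → Odd (NumberField.discr K) →
        IsCoprime (NumberField.discr K) (N : ℤ) → W.conductorNorm ℤ = N →
        SatisfiesHeegnerHypothesis N K → ((Ideal.span {(p : ℤ)}).primesOver (𝓞 K)).ncard = 2 →
        ∀ (DK : WeierstrassCurve.PAdicHeightDataK W p K), DK.IsCanonical →
        ∀ (P : (W.baseChange K).toAffine.Point), IsHeegnerPoint N W K P →
        analyticRankEK W K = 1 →
          ((padicLFunctionEK W p K hf hg).order = (analyticRankEK W K : ℕ∞) ↔ DK.height P ≠ 0))
    {W : WeierstrassCurve ℚ} [W.IsElliptic] [W.IsGloballyMinimal] {p : ℕ} [Fact p.Prime]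
    {K : Type} [Field K] [NumberField K] {N : ℕ} [NeZero N]
    {Nf Ng : ℕ} [NeZero Nf] [NeZero Ng] {f : CuspForm (Gamma0 Nf) 2} {g : CuspForm (Gamma0 Ng) 2}
    (hf : IsNewformOf W f) (hg : IsNewformOf (W.quadraticTwist (NumberField.discr K : ℚ)) g)
    (hp : 5 ≤ p) (hgood : W.HasGoodReductionAtPrime p) (hord : ¬ (p : ℤ) ∣ W.frobeniusTrace p)
    (hK : IsImaginaryQuadratic K) (hodd : Odd (NumberField.discr K))
    (hcop : IsCoprime (NumberField.discr K) (N : ℤ)) (hN : W.conductorNorm ℤ = N)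
    (hH : SatisfiesHeegnerHypothesis N K)
    (hsplit : ((Ideal.span {(p : ℤ)}).primesOver (𝓞 K)).ncard = 2)
    {DK : WeierstrassCurve.PAdicHeightDataK W p K} (hDK : DK.IsCanonical)
    {P : (W.baseChange K).toAffine.Point} (hP : IsHeegnerPoint N W K P)
    (hr : analyticRankEK W K = 1) :
    (1 : ℕ∞) ≤ (padicLFunctionEK W p K hf hg).order ∧
      ((padicLFunctionEK W p K hf hg).order = 1 ↔ DK.height P ≠ 0) := by
  refine ⟨PowerSeries.nat_le_order _ 1 fun i hi ↦ ?_, ?_⟩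
  · obtain rfl : i = 0 := by omega
    rw [PowerSeries.coeff_zero_eq_constantCoeff_apply]
    exact constantCoeff_padicLFunctionEK_eq_zero_of_analyticRankEK_eq_one hf hg hp hgood hord hK
      hsplit hr
  · have key := h W p K N hf hg hp hgood hord hK hodd hcop hN hH hsplit DK hDK P hP hr
    rwa [hr, Nat.cast_one] at key

end Characterisation

/-! ### The narrowed barrier statement: same characterisation, same upstream fact -/

section Narrow

/-- **(narrowed barrier statement) ↔ (barrier statement).** The statement of the narrowed
barrier `PAdicHeightBarrierNarrow` is (barrier statement) `∧` (the pair and conjugate-pair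
algebra on `E(ℚ)` — the mechanism of the critical-slope and supersingular evasions recorded by the
barrier audit), both written out here; its second conjunct is the theorem
`padicHeightBarrierNarrow_gap` of the barrier file, so the narrowed statement is EQUIVALENT to the
catalogued one: in either, all that is not proved is the analytic face in rank one. [folklore] -/
theorem padicHeightBarrierNarrow_iff :
    ((∀ (W : WeierstrassCurve ℚ) [W.IsElliptic] [W.IsGloballyMinimal] (p : ℕ) [Fact p.Prime]
        (K : Type) [Field K] [NumberField K] (N : ℕ) [NeZero N]
        {Nf Ng : ℕ} [NeZero Nf] [NeZero Ng] {f : CuspForm (Gamma0 Nf) 2}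
        {g : CuspForm (Gamma0 Ng) 2}
        (hf : IsNewformOf W f) (hg : IsNewformOf (W.quadraticTwist (NumberField.discr K : ℚ)) g),
        5 ≤ p → W.HasGoodReductionAtPrime p → ¬ (p : ℤ) ∣ W.frobeniusTrace p →
        IsImaginaryQuadratic K → Odd (NumberField.discr K) →
        IsCoprime (NumberField.discr K) (N : ℤ) → W.conductorNorm ℤ = N →
        SatisfiesHeegnerHypothesis N K → ((Ideal.span {(p : ℤ)}).primesOver (𝓞 K)).ncard = 2 →
        ∀ (DK : WeierstrassCurve.PAdicHeightDataK W p K), DK.IsCanonical →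
        ∀ (P : (W.baseChange K).toAffine.Point), IsHeegnerPoint N W K P →
        analyticRankEK W K = 1 →
          ((padicLFunctionEK W p K hf hg).order = (analyticRankEK W K : ℕ∞) ↔ DK.height P ≠ 0)) ∧
      ∀ (W : WeierstrassCurve ℚ) (L : Type) [Field L] (σ : L →+* L)
        (h₁ h₂ : W.toAffine.Point → L) (ℓ : W.toAffine.Point →+ L) (c : L),
        c ≠ 0 → (∀ P, h₁ P - h₂ P = c * ℓ P ^ 2) → (∀ P, ¬ IsOfFinAddOrder P → ℓ P ≠ 0) →
        ∀ P, ¬ IsOfFinAddOrder P →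
          (h₁ P ≠ 0 ∨ h₂ P ≠ 0) ∧ ((∀ Q, σ (h₁ Q) = h₂ Q) → h₁ P ≠ 0 ∧ h₂ P ≠ 0)) ↔
    ∀ (W : WeierstrassCurve ℚ) [W.IsElliptic] [W.IsGloballyMinimal] (p : ℕ) [Fact p.Prime]
      (K : Type) [Field K] [NumberField K] (N : ℕ) [NeZero N]
      {Nf Ng : ℕ} [NeZero Nf] [NeZero Ng] {f : CuspForm (Gamma0 Nf) 2}
      {g : CuspForm (Gamma0 Ng) 2}
      (hf : IsNewformOf W f) (hg : IsNewformOf (W.quadraticTwist (NumberField.discr K : ℚ)) g),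
      5 ≤ p → W.HasGoodReductionAtPrime p → ¬ (p : ℤ) ∣ W.frobeniusTrace p →
      IsImaginaryQuadratic K → Odd (NumberField.discr K) →
      IsCoprime (NumberField.discr K) (N : ℤ) → W.conductorNorm ℤ = N →
      SatisfiesHeegnerHypothesis N K → ((Ideal.span {(p : ℤ)}).primesOver (𝓞 K)).ncard = 2 →
      ∀ (DK : WeierstrassCurve.PAdicHeightDataK W p K), DK.IsCanonical →
      ∀ (P : (W.baseChange K).toAffine.Point), IsHeegnerPoint N W K P →
      analyticRankEK W K = 1 →
        ((padicLFunctionEK W p K hf hg).order = (analyticRankEK W K : ℕ∞) ↔ DK.height P ≠ 0) :=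
  ⟨And.left, fun h ↦ ⟨h, fun W L _ σ h₁ h₂ ℓ c hc hdiff hℓ P hP ↦
    padicHeightBarrierNarrow_gap W L σ h₁ h₂ ℓ c hc hdiff hℓ P hP⟩⟩

/-- **(narrowed barrier statement) ↔ the derivative clause of Perrin-Riou 1987, Thm. 1.3, in
analytic rank one** (`padicHeightBarrierNarrow_iff` composed with
`padicHeightBarrier_iff_forall_coeff_one_iff`): the statement of the narrowed barrier
`PAdicHeightBarrierNarrow`, too, is EXACTLY the rank-one
case of the normalisation-free derivative formula `coeff_1 L_p(E/K,T) = 0 ↔ ⟨P_K,P_K⟩_{p,K} = 0`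
(source form `L'_{p,ρ}(E,𝒞₀) = (1 - 1/α_p)⁴ ⟨Q,Q⟩_{ρ_H,E}/(h u² deg π)`, p. 463), i.e. the
analytic-rank-one case of the second conjunct of the named fact
`Literature.NumberTheory.EllipticCurves.perrinRiou_padicGrossZagier` — no more (neither the
constant-term clause nor the higher-rank part of Thm. 1.3 is needed) and no less (nothing short of
the rank-one derivative formula closes it). [cite: PerrinRiou1987, Thm. 1.3 (p. 461) and p. 463] -/
theorem padicHeightBarrierNarrow_iff_forall_coeff_one_iff :
    ((∀ (W : WeierstrassCurve ℚ) [W.IsElliptic] [W.IsGloballyMinimal] (p : ℕ) [Fact p.Prime]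
        (K : Type) [Field K] [NumberField K] (N : ℕ) [NeZero N]
        {Nf Ng : ℕ} [NeZero Nf] [NeZero Ng] {f : CuspForm (Gamma0 Nf) 2}
        {g : CuspForm (Gamma0 Ng) 2}
        (hf : IsNewformOf W f) (hg : IsNewformOf (W.quadraticTwist (NumberField.discr K : ℚ)) g),
        5 ≤ p → W.HasGoodReductionAtPrime p → ¬ (p : ℤ) ∣ W.frobeniusTrace p →
        IsImaginaryQuadratic K → Odd (NumberField.discr K) →
        IsCoprime (NumberField.discr K) (N : ℤ) → W.conductorNorm ℤ = N →
        SatisfiesHeegnerHypothesis N K → ((Ideal.span {(p : ℤ)}).primesOver (𝓞 K)).ncard = 2 →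
        ∀ (DK : WeierstrassCurve.PAdicHeightDataK W p K), DK.IsCanonical →
        ∀ (P : (W.baseChange K).toAffine.Point), IsHeegnerPoint N W K P →
        analyticRankEK W K = 1 →
          ((padicLFunctionEK W p K hf hg).order = (analyticRankEK W K : ℕ∞) ↔ DK.height P ≠ 0)) ∧
      ∀ (W : WeierstrassCurve ℚ) (L : Type) [Field L] (σ : L →+* L)
        (h₁ h₂ : W.toAffine.Point → L) (ℓ : W.toAffine.Point →+ L) (c : L),
        c ≠ 0 → (∀ P, h₁ P - h₂ P = c * ℓ P ^ 2) → (∀ P, ¬ IsOfFinAddOrder P → ℓ P ≠ 0) →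
        ∀ P, ¬ IsOfFinAddOrder P →
          (h₁ P ≠ 0 ∨ h₂ P ≠ 0) ∧ ((∀ Q, σ (h₁ Q) = h₂ Q) → h₁ P ≠ 0 ∧ h₂ P ≠ 0)) ↔
      ∀ (W : WeierstrassCurve ℚ) [W.IsElliptic] [W.IsGloballyMinimal] (p : ℕ) [Fact p.Prime]
        (K : Type) [Field K] [NumberField K] (N : ℕ) [NeZero N]
        {Nf Ng : ℕ} [NeZero Nf] [NeZero Ng] {f : CuspForm (Gamma0 Nf) 2}
        {g : CuspForm (Gamma0 Ng) 2}
        (hf : IsNewformOf W f) (hg : IsNewformOf (W.quadraticTwist (NumberField.discr K : ℚ)) g),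
        5 ≤ p → W.HasGoodReductionAtPrime p → ¬ (p : ℤ) ∣ W.frobeniusTrace p →
        IsImaginaryQuadratic K → Odd (NumberField.discr K) →
        IsCoprime (NumberField.discr K) (N : ℤ) → W.conductorNorm ℤ = N →
        SatisfiesHeegnerHypothesis N K → ((Ideal.span {(p : ℤ)}).primesOver (𝓞 K)).ncard = 2 →
        ∀ (DK : WeierstrassCurve.PAdicHeightDataK W p K), DK.IsCanonical →
        ∀ (P : (W.baseChange K).toAffine.Point), IsHeegnerPoint N W K P →
        analyticRankEK W K = 1 →
          (PowerSeries.coeff 1 (padicLFunctionEK W p K hf hg) = 0 ↔ DK.height P = 0) :=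
  padicHeightBarrierNarrow_iff.trans padicHeightBarrier_iff_forall_coeff_one_iff

end Narrow

end Literature.Barriers.BirchSwinnertonDyer

end
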